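import Literature.Computability.AlgebraicComplexity.ChowCoeffIdeal
import Mathlib.RingTheory.MvPolynomial.WeightedHomogeneous
import HarnessLib

/-!
# Balanced multisymmetric polynomials on matrix space: the ring `𝒪(V^m // H_m)`

Setting of `ChowPullback.lean` (`k[Mat_m] = MvPolynomial (Fin m × Fin m) k`, the variable
`X (i, j)` being the `i`-th coefficient of the `j`-th linear form). Following
Bürgisser–Hüttenhain–Ikenmeyer, Proc. AMS 145 (2017) = arXiv:1501.05528, §3 (proof of Lemma 4):
"`𝒪(V^n) = ⊕_{k_1,…,k_n} Sym^{k_1} V^* ⊗ ⋯ ⊗ Sym^{k_n} V^*`. Taking `T_n`-invariants yields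
`𝒪(V^n)^{T_n} = ⊕_k Sym^k V^* ⊗ ⋯ ⊗ Sym^k V^*`. Taking `S_n`-invariants gives
`𝒪(V^n // H_n) ≃ 𝒪(V^n)^{T_n ⋊ S_n} = ⊕_k Sym^n Sym^k V^*`", this file defines

* the column multidegree (`colWeight`, `weight_colWeight_apply`) and BALANCED polynomials of
  degree `δ` (`IsBalanced m δ`: every monomial has degree `δ` in each column — the
  `T_m`-invariants of multidegree `(δ,…,δ)`, i.e. `Sym^δ V^* ⊗ ⋯ ⊗ Sym^δ V^*`);
* FORM-SYMMETRIC polynomials (`IsFormSymm`: invariant under permuting the columns = the forms,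
  the `S_m`-action) and the symmetrisation operator `symmetrize` (sum over `S_m`);
* the graded pieces `symBalanced m δ = 𝒪(V^m // H_m)_δ ≅ Sym^m Sym^δ V^*` of BHI's ring (5).

and proves the algebra needed downstream: products/powers of balanced symmetric polynomials,
the weighted-homogeneous-component-of-a-product lemma (`weightedHomogeneousComponent_mul_left`),
that the `v`-coefficients of `(ℓ_0⋯ℓ_{m-1})^t` lie in `symBalanced m t`
(`coeff_genericProduct_pow_mem_symBalanced`: they are images of the pullback, BHI's
"`ψ_n^*` is a homomorphism of graded `ℂ`-algebras" with degree `nk ↦ k`), and the **division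
lemma** `exists_eq_sum_mul_of_mem_span` (characteristic zero): a balanced symmetric `y` of degree
`t + e` lying in the ideal generated by finitely many elements `c_i ∈ symBalanced m t` is
`∑ c_i a_i` with `a_i ∈ symBalanced m e` (project to the balanced component, then average over
`S_m` — the Reynolds operator of `H_m = T_m ⋊ S_m`).

## References

* [BurgisserHuttenhainIkenmeyer2017] §3, Lemma 4 and its proof ((5), the grading "degree `n·k`
  becomes degree `k`").
-/

noncomputable section

open MvPolynomial

namespace Literature.Computability.AlgebraicComplexity

variable {k : Type*} [Field k] (m : ℕ)

/-! ### Column degrees and balanced polynomials -/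

/-- The column weight of the variable `X (i, j)`: the `j`-th unit vector of `ℕ^m` (so that the
weighted degree of a monomial is its vector of column degrees, `weight_colWeight_apply`).
[cite: BurgisserHuttenhainIkenmeyer2017, §3 (proof of Lemma 4: the multigrading of 𝒪(V^n))] -/
def colWeight : Fin m × Fin m → (Fin m → ℕ) := fun v => Pi.single v.2 1

/-- The weighted degree of a monomial for `colWeight` is its vector of column degrees.
[folklore] -/
theorem weight_colWeight_apply (s : Fin m × Fin m →₀ ℕ) (j : Fin m) :
    Finsupp.weight (colWeight m) s j = ∑ i : Fin m, s (i, j) := by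
  classical
  rw [Finsupp.weight_apply, Finsupp.sum, Finset.sum_apply]
  simp only [Pi.smul_apply, colWeight, Pi.single_apply, smul_eq_mul, mul_ite, mul_one, mul_zero]
  rw [Finset.sum_subset (Finset.subset_univ s.support) (fun v _ hv => by
      rw [Finsupp.notMem_support_iff.mp hv]
      simp)]
  rw [Fintype.sum_prod_type]
  refine Finset.sum_congr rfl fun i _ => ?_
  rw [Finset.sum_ite_eq Finset.univ j (fun j' => s (i, j')), if_pos (Finset.mem_univ j)]

/-- **Balanced of degree `δ`**: every monomial has degree `δ` in each column of variables
(weighted-homogeneous of weighted degree `(δ,…,δ)` for `colWeight`); these span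
`Sym^δ V^* ⊗ ⋯ ⊗ Sym^δ V^* = 𝒪(V^m)^{T_m}_δ`.
[cite: BurgisserHuttenhainIkenmeyer2017, §3 (proof of Lemma 4: T_n-invariants)] -/
def IsBalanced (δ : ℕ) (G : MvPolynomial (Fin m × Fin m) k) : Prop :=
  IsWeightedHomogeneous (colWeight m) G (fun _ : Fin m => δ)

/-- Balancedness in terms of column degrees of monomials. [folklore] -/
theorem isBalanced_iff (δ : ℕ) (G : MvPolynomial (Fin m × Fin m) k) :
    IsBalanced m δ G ↔ ∀ s ∈ G.support, ∀ j : Fin m, ∑ i : Fin m, s (i, j) = δ := by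
  simp only [IsBalanced, IsWeightedHomogeneous, mem_support_iff, funext_iff, weight_colWeight_apply]

variable {m} in
/-- Products of balanced polynomials are balanced, degrees adding. [folklore] -/
theorem IsBalanced.mul {δ ε : ℕ} {a b : MvPolynomial (Fin m × Fin m) k} (ha : IsBalanced m δ a)
    (hb : IsBalanced m ε b) : IsBalanced m (δ + ε) (a * b) := by
  have h := IsWeightedHomogeneous.mul ha hb
  rwa [show ((fun _ : Fin m => δ) + fun _ : Fin m => ε) = fun _ => δ + ε from rfl] at h

variable {m} in
/-- Powers of balanced polynomials are balanced. [folklore] -/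
theorem IsBalanced.pow {δ : ℕ} {a : MvPolynomial (Fin m × Fin m) k} (ha : IsBalanced m δ a)
    (n : ℕ) : IsBalanced m (n * δ) (a ^ n) := by
  have h := IsWeightedHomogeneous.pow ha n
  rwa [show (n • fun _ : Fin m => δ) = fun _ => n * δ by funext j; simp] at h

/-! ### Permuting the forms: form-symmetric polynomials and symmetrisation -/

/-- **Form-symmetric**: invariant under every permutation of the columns (the forms) — the
`S_m`-invariants of `𝒪(V^m)`. [cite: BurgisserHuttenhainIkenmeyer2017, §3 (proof of Lemma 4: S_n-invariants)] -/
def IsFormSymm (G : MvPolynomial (Fin m × Fin m) k) : Prop :=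
  ∀ τ : Equiv.Perm (Fin m), rename (Prod.map id ⇑τ) G = G

/-- Composing two column permutations. [folklore] -/
theorem rename_prodMap_rename_prodMap (σ τ : Equiv.Perm (Fin m))
    (G : MvPolynomial (Fin m × Fin m) k) :
    rename (Prod.map id ⇑σ) (rename (Prod.map id ⇑τ) G) = rename (Prod.map id ⇑(σ * τ)) G := by
  rw [rename_rename]
  congr 1

/-- **Symmetrisation** over the forms: `∑_{τ ∈ S_m} τ · G`. [cite: BurgisserHuttenhainIkenmeyer2017, §3 (proof of Lemma 4: taking S_n-invariants)] -/
def symmetrize (G : MvPolynomial (Fin m × Fin m) k) : MvPolynomial (Fin m × Fin m) k :=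
  ∑ τ : Equiv.Perm (Fin m), rename (Prod.map id ⇑τ) G

/-- The symmetrisation is form-symmetric. [folklore] -/
theorem isFormSymm_symmetrize (G : MvPolynomial (Fin m × Fin m) k) :
    IsFormSymm m (symmetrize m G) := by
  intro σ
  rw [symmetrize, map_sum]
  simp_rw [rename_prodMap_rename_prodMap]
  exact Fintype.sum_equiv (Equiv.mulLeft σ) _ _ fun τ => rfl

variable {m} in
/-- Symmetrising a form-symmetric polynomial multiplies it by `m!`. [folklore] -/
theorem IsFormSymm.symmetrize_eq {G : MvPolynomial (Fin m × Fin m) k} (h : IsFormSymm m G) :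
    symmetrize m G = (Fintype.card (Equiv.Perm (Fin m)) : k) • G := by
  rw [symmetrize, Finset.sum_congr rfl fun τ _ => h τ, Finset.sum_const, Finset.card_univ,
    Nat.cast_smul_eq_nsmul]

variable {m} in
/-- Symmetrisation is linear over form-symmetric factors. [folklore] -/
theorem IsFormSymm.symmetrize_mul {c : MvPolynomial (Fin m × Fin m) k} (hc : IsFormSymm m c)
    (a : MvPolynomial (Fin m × Fin m) k) : symmetrize m (c * a) = c * symmetrize m a := by
  rw [symmetrize, symmetrize, Finset.mul_sum]
  exact Finset.sum_congr rfl fun τ _ => by rw [map_mul, hc τ]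

/-- Symmetrisation is additive. [folklore] -/
theorem symmetrize_add (a b : MvPolynomial (Fin m × Fin m) k) :
    symmetrize m (a + b) = symmetrize m a + symmetrize m b := by
  simp [symmetrize, map_add, Finset.sum_add_distrib]

/-- Symmetrisation of a finite sum. [folklore] -/
theorem symmetrize_sum {ι : Type*} (s : Finset ι) (a : ι → MvPolynomial (Fin m × Fin m) k) :
    symmetrize m (∑ i ∈ s, a i) = ∑ i ∈ s, symmetrize m (a i) := by
  simp only [symmetrize, map_sum]
  rw [Finset.sum_comm]

/-- Symmetrisation commutes with scalars. [folklore] -/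
theorem symmetrize_smul (c : k) (a : MvPolynomial (Fin m × Fin m) k) :
    symmetrize m (c • a) = c • symmetrize m a := by
  simp [symmetrize, map_smul, Finset.smul_sum]

variable {m} in
/-- A column permutation preserves balancedness (the multidegree `(δ,…,δ)` is permutation
invariant). [folklore] -/
theorem IsBalanced.rename_prodMap {δ : ℕ} {G : MvPolynomial (Fin m × Fin m) k}
    (h : IsBalanced m δ G) (τ : Equiv.Perm (Fin m)) :
    IsBalanced m δ (rename (Prod.map id ⇑τ) G) := by
  intro d hd
  obtain ⟨u, hu, hcu⟩ := coeff_rename_ne_zero _ _ _ hd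
  have hwu : Finsupp.weight (colWeight m) u = fun _ => δ := h hcu
  rw [← hu]
  funext j
  rw [weight_colWeight_apply]
  have hinj : Function.Injective (Prod.map id ⇑τ : Fin m × Fin m → Fin m × Fin m) :=
    Function.Injective.prodMap Function.injective_id τ.injective
  have hterm : ∀ i : Fin m, Finsupp.mapDomain (Prod.map id ⇑τ) u (i, j) = u (i, τ.symm j) := by
    intro i
    have : ((i, j) : Fin m × Fin m) = Prod.map id ⇑τ (i, τ.symm j) := by simp
    rw [this, Finsupp.mapDomain_apply hinj]
  simp_rw [hterm]
  rw [← weight_colWeight_apply, hwu]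

variable {m} in
/-- Symmetrisation preserves balancedness. [folklore] -/
theorem IsBalanced.symmetrize {δ : ℕ} {G : MvPolynomial (Fin m × Fin m) k}
    (h : IsBalanced m δ G) : IsBalanced m δ (symmetrize m G) :=
  IsWeightedHomogeneous.sum _ _ _ fun τ _ => h.rename_prodMap τ

/-! ### The graded pieces `𝒪(V^m // H_m)_δ ≅ Sym^m Sym^δ V^*` -/

/-- **The degree-`δ` piece of `𝒪(V^m // H_m)`**: balanced of degree `δ` and form-symmetric
polynomials on `Mat_m` — BHI (5): "`𝒪(V^n // H_n) ≃ 𝒪(V^n)^{T_n ⋊ S_n} = ⊕_k Sym^n Sym^k V^*`",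
with the grading "degree `n·k` becomes degree `k`" (proof of Prop. 2).
[cite: BurgisserHuttenhainIkenmeyer2017, §3 (Lemma 4, (5))] -/
def symBalanced (δ : ℕ) : Submodule k (MvPolynomial (Fin m × Fin m) k) where
  carrier := {G | IsBalanced m δ G ∧ IsFormSymm m G}
  add_mem' {a b} ha hb := ⟨ha.1.add hb.1, fun τ => by rw [map_add, ha.2 τ, hb.2 τ]⟩
  zero_mem' := ⟨isWeightedHomogeneous_zero _ _ _, fun τ => map_zero _⟩
  smul_mem' c {G} hG := ⟨by
    rw [smul_eq_C_mul]
    exact hG.1.C_mul c, fun τ => by rw [map_smul, hG.2 τ]⟩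

/-- Membership in `symBalanced`, unfolded. [folklore] -/
theorem mem_symBalanced_iff (δ : ℕ) (G : MvPolynomial (Fin m × Fin m) k) :
    G ∈ symBalanced m δ ↔ IsBalanced m δ G ∧ IsFormSymm m G :=
  Iff.rfl

/-- `1 ∈ 𝒪(V^m // H_m)_0`. [folklore] -/
theorem one_mem_symBalanced : (1 : MvPolynomial (Fin m × Fin m) k) ∈ symBalanced m 0 :=
  ⟨isWeightedHomogeneous_one _ _, fun _ => map_one _⟩

/-- `𝒪(V^m // H_m)` is a graded subring: products. [cite: BurgisserHuttenhainIkenmeyer2017, §3 ((5), graded ℂ-algebra)] -/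
theorem mul_mem_symBalanced {δ ε : ℕ} {a b : MvPolynomial (Fin m × Fin m) k}
    (ha : a ∈ symBalanced m δ) (hb : b ∈ symBalanced m ε) : a * b ∈ symBalanced m (δ + ε) :=
  ⟨ha.1.mul hb.1, fun τ => by rw [map_mul, ha.2 τ, hb.2 τ]⟩

/-- `𝒪(V^m // H_m)` is a graded subring: powers. [cite: BurgisserHuttenhainIkenmeyer2017, §3 ((5), graded ℂ-algebra)] -/
theorem pow_mem_symBalanced {δ : ℕ} {a : MvPolynomial (Fin m × Fin m) k} (ha : a ∈ symBalanced m δ)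
    (n : ℕ) : a ^ n ∈ symBalanced m (n * δ) :=
  ⟨ha.1.pow n, fun τ => by rw [map_pow, ha.2 τ]⟩

/-- Symmetrising a balanced polynomial lands in `𝒪(V^m // H_m)_δ`. [folklore] -/
theorem symmetrize_mem_symBalanced {δ : ℕ} {G : MvPolynomial (Fin m × Fin m) k}
    (h : IsBalanced m δ G) : symmetrize m G ∈ symBalanced m δ :=
  ⟨h.symmetrize, isFormSymm_symmetrize m G⟩

/-! ### Weighted homogeneous components of products -/

/-- **The component of a product with a weighted-homogeneous factor** (cancellative weights):
`(c · a)_{d₀ + e} = c · a_e` for `c` weighted-homogeneous of degree `d₀`. [folklore] -/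
theorem weightedHomogeneousComponent_mul_left {σ M R : Type*} [CommSemiring R]
    [AddCancelCommMonoid M] [DecidableEq M] {w : σ → M} {c : MvPolynomial σ R} {d₀ : M}
    (hc : IsWeightedHomogeneous w c d₀) (a : MvPolynomial σ R) (e : M) :
    weightedHomogeneousComponent w (d₀ + e) (c * a) =
      c * weightedHomogeneousComponent w e a := by
  classical
  ext s
  rw [coeff_weightedHomogeneousComponent, coeff_mul, coeff_mul]
  simp_rw [coeff_weightedHomogeneousComponent]
  split_ifs with hs
  · refine Finset.sum_congr rfl fun p hp => ?_
    rw [Finset.mem_antidiagonal] at hp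
    by_cases hu : coeff p.1 c = 0
    · rw [hu, zero_mul, zero_mul]
    · have hwu : Finsupp.weight w p.1 = d₀ := hc hu
      have hwv : Finsupp.weight w p.2 = e := by
        have := congrArg (Finsupp.weight w) hp
        rw [map_add, hwu, hs] at this
        exact add_left_cancel this
      rw [if_pos hwv]
  · symm
    refine Finset.sum_eq_zero fun p hp => ?_
    rw [Finset.mem_antidiagonal] at hp
    by_cases hu : coeff p.1 c = 0
    · rw [hu, zero_mul]
    · have hwu : Finsupp.weight w p.1 = d₀ := hc hu
      rw [if_neg, mul_zero]
      intro hwv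
      apply hs
      rw [← hp, map_add, hwu, hwv]

/-! ### The `v`-coefficients of `(ℓ_0⋯ℓ_{m-1})^t` lie in `𝒪(V^m // H_m)_t` -/

/-- A `v`-coefficient of `ℓ_j^t` is (a multiple of) a monomial of degree `t` in column `j`: it is
weighted-homogeneous of degree `t e_j`. [folklore] -/
theorem isWeightedHomogeneous_coeff_genericLinForm_pow (j : Fin m) (α : Fin m →₀ ℕ) (t : ℕ) :
    IsWeightedHomogeneous (colWeight m) (coeff α (genericLinForm (k := k) m j ^ t))
      (Pi.single j t) := by
  classical
  have hform : genericLinForm (k := k) m j =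
      ∑ i : Fin m, (X (i, j) : MvPolynomial (Fin m × Fin m) k) • X i := by
    simp only [genericLinForm, smul_eq_C_mul]
  rw [hform, coeff_linearCombination_X_pow_of_fintype]
  split_ifs with hα
  · rw [← map_natCast (C : k →+* MvPolynomial (Fin m × Fin m) k)]
    refine IsWeightedHomogeneous.C_mul ?_ _
    have hprod := IsWeightedHomogeneous.prod α.support
      (fun i => (X (i, j) : MvPolynomial (Fin m × Fin m) k) ^ α i)
      (fun i => α i • colWeight m (i, j)) (w := colWeight m)
      fun i _ => (isWeightedHomogeneous_X _ _ _).pow _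
    have hsum : ∑ i ∈ α.support, α i • colWeight m (i, j) = Pi.single j t := by
      simp only [colWeight]
      rw [← Finset.sum_smul, ← Pi.single_smul', smul_eq_mul, mul_one]
      rw [← hα, Finsupp.sum]
    rw [hsum] at hprod
    exact hprod
  · exact isWeightedHomogeneous_zero _ _ _

/-- The `v`-coefficients of `∏_{j ∈ S} ℓ_j^t` are weighted-homogeneous of column degrees `t` on
`S` and `0` off `S`. [folklore] -/
theorem isWeightedHomogeneous_coeff_prod_genericLinForm_pow (S : Finset (Fin m)) (t : ℕ)
    (γ : Fin m →₀ ℕ) :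
    IsWeightedHomogeneous (colWeight m) (coeff γ (∏ j ∈ S, genericLinForm (k := k) m j ^ t))
      (∑ j ∈ S, Pi.single j t) := by
  classical
  induction S using Finset.induction_on generalizing γ with
  | empty =>
    rw [Finset.prod_empty, Finset.sum_empty, coeff_one]
    split_ifs
    · exact isWeightedHomogeneous_one _ _
    · exact isWeightedHomogeneous_zero _ _ _
  | insert j₀ S hj₀ ih =>
    rw [Finset.prod_insert hj₀, Finset.sum_insert hj₀, coeff_mul]
    refine IsWeightedHomogeneous.sum _ _ _ fun p _ => ?_
    exact (isWeightedHomogeneous_coeff_genericLinForm_pow m j₀ p.1 t).mul (ih p.2)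

/-- **The `v`-coefficients of `(ℓ_0⋯ℓ_{m-1})^t` are balanced of degree `t`.**
[cite: BurgisserHuttenhainIkenmeyer2017, §3 (ψ_n^* is a homomorphism of graded algebras)] -/
theorem isBalanced_coeff_genericProduct_pow (t : ℕ) (γ : Fin m →₀ ℕ) :
    IsBalanced m t (coeff γ (genericProduct (k := k) m ^ t)) := by
  have h := isWeightedHomogeneous_coeff_prod_genericLinForm_pow (k := k) m Finset.univ t γ
  rw [Finset.prod_pow, Finset.univ_sum_single] at h
  exact h

/-- Permuting the forms permutes the generic linear forms. [folklore] -/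
theorem map_rename_prodMap_genericLinForm (τ : Equiv.Perm (Fin m)) (j : Fin m) :
    MvPolynomial.map (rename (Prod.map id ⇑τ) :
        MvPolynomial (Fin m × Fin m) k →ₐ[k] MvPolynomial (Fin m × Fin m) k).toRingHom
      (genericLinForm (k := k) m j) = genericLinForm (k := k) m (τ j) := by
  simp only [genericLinForm, map_sum, map_mul, map_C, map_X, AlgHom.toRingHom_eq_coe,
    RingHom.coe_coe, rename_X, Prod.map_apply, id_eq]

/-- The generic product is invariant under permuting the forms. [folklore] -/
theorem map_rename_prodMap_genericProduct (τ : Equiv.Perm (Fin m)) :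
    MvPolynomial.map (rename (Prod.map id ⇑τ) :
        MvPolynomial (Fin m × Fin m) k →ₐ[k] MvPolynomial (Fin m × Fin m) k).toRingHom
      (genericProduct (k := k) m) = genericProduct (k := k) m := by
  rw [genericProduct, map_prod]
  simp_rw [map_rename_prodMap_genericLinForm]
  exact Equiv.prod_comp τ (fun j => genericLinForm (k := k) m j)

/-- **The `v`-coefficients of `(ℓ_0⋯ℓ_{m-1})^t` are form-symmetric.** [folklore] -/
theorem isFormSymm_coeff_genericProduct_pow (t : ℕ) (γ : Fin m →₀ ℕ) :
    IsFormSymm m (coeff γ (genericProduct (k := k) m ^ t)) := by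
  intro τ
  have h := congrArg (fun p => coeff γ (p ^ t)) (map_rename_prodMap_genericProduct (k := k) m τ)
  simp only [← map_pow, coeff_map, AlgHom.toRingHom_eq_coe, RingHom.coe_coe] at h
  exact h

/-- **The `v`-coefficients of `(ℓ_0⋯ℓ_{m-1})^t` lie in `𝒪(V^m // H_m)_t`** (they are pullbacks of
degree-`t` polynomial functions on `Sym^m`). [cite: BurgisserHuttenhainIkenmeyer2017, §3 (ψ_n^* : 𝒪(Chow_n) → 𝒪(V^n)^{H_n}, graded)] -/
theorem coeff_genericProduct_pow_mem_symBalanced (t : ℕ) (γ : Fin m →₀ ℕ) :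
    coeff γ (genericProduct (k := k) m ^ t) ∈ symBalanced m t :=
  ⟨isBalanced_coeff_genericProduct_pow m t γ, isFormSymm_coeff_genericProduct_pow m t γ⟩

/-! ### The division lemma (the Reynolds operator of `H_m`) -/

/-- **Division lemma.** In characteristic zero, let `c_i ∈ 𝒪(V^m // H_m)_t` (`i` in a finite index
set) and let `y ∈ 𝒪(V^m // H_m)_{t+e}` lie in the ideal of `k[Mat_m]` generated by the `c_i`. Then
`y = ∑_i c_i a_i` with `a_i ∈ 𝒪(V^m // H_m)_e`: write `y = ∑ c_i b_i`, replace `b_i` by its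
balanced component of degree `e` (`weightedHomogeneousComponent_mul_left`), then by its average over
`S_m` (`IsFormSymm.symmetrize_mul`) — the Reynolds operator of `H_m = T_m ⋊ S_m` is
`𝒪(V^m // H_m)`-linear. [folklore] -/
theorem exists_eq_sum_mul_of_mem_span [CharZero k] {t e : ℕ} {ι : Type*} [Fintype ι]
    (c : ι → MvPolynomial (Fin m × Fin m) k) (hc : ∀ i, c i ∈ symBalanced m t)
    {y : MvPolynomial (Fin m × Fin m) k} (hy : y ∈ symBalanced m (t + e))
    (hyI : y ∈ Ideal.span (Set.range c)) :
    ∃ a : ι → MvPolynomial (Fin m × Fin m) k, (∀ i, a i ∈ symBalanced m e) ∧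
      y = ∑ i, c i * a i := by
  classical
  obtain ⟨b, hb⟩ := Ideal.mem_span_range_iff_exists_fun.mp hyI
  -- step 1: balanced components
  set a₀ : ι → MvPolynomial (Fin m × Fin m) k := fun i =>
    weightedHomogeneousComponent (colWeight m) (fun _ : Fin m => e) (b i) with ha₀
  have hy₀ : y = ∑ i, c i * a₀ i := by
    have hyy : weightedHomogeneousComponent (colWeight m) (fun _ : Fin m => t + e) y = y :=
      hy.1.weightedHomogeneousComponent_same
    rw [← hyy, ← hb, map_sum]
    refine Finset.sum_congr rfl fun i _ => ?_
    rw [mul_comm (b i) (c i),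
      show (fun _ : Fin m => t + e) = (fun _ : Fin m => t) + fun _ : Fin m => e from rfl,
      weightedHomogeneousComponent_mul_left (hc i).1]
  -- step 2: average over the forms
  set N : k := (Fintype.card (Equiv.Perm (Fin m)) : k) with hN
  have hN0 : N ≠ 0 := by
    rw [hN, Nat.cast_ne_zero]
    exact Fintype.card_ne_zero
  have hNy : N • y = ∑ i, c i * symmetrize m (a₀ i) := by
    rw [← hy.2.symmetrize_eq, hy₀, symmetrize_sum]
    exact Finset.sum_congr rfl fun i _ => (hc i).2.symmetrize_mul (a₀ i)
  refine ⟨fun i => N⁻¹ • symmetrize m (a₀ i), fun i => ?_, ?_⟩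
  · exact (symBalanced m e).smul_mem _ (symmetrize_mem_symBalanced m
      (weightedHomogeneousComponent_isWeightedHomogeneous _ (b i)))
  · have := congrArg (fun z => N⁻¹ • z) hNy
    simp only [smul_smul, inv_mul_cancel₀ hN0, one_smul, Finset.smul_sum] at this
    rw [this]
    exact Finset.sum_congr rfl fun i _ => (mul_smul_comm _ _ _).symm

end Literature.Computability.AlgebraicComplexity


/-!
# Finiteness of the normalisation of the Chow variety over its coordinate ring (BHI Lemma 3)

Setting of `ChowPullback.lean` and the first part of this file: `R := im(chowPullback m) ⊆ k[Mat_m]` is the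
coordinate ring `𝒪(Chow_m)` of the Chow variety embedded by the comorphism of the product map, and
`R̃ := ⊕_δ symBalanced m δ = 𝒪(V^m // H_m)` is the coordinate ring of its normalisation
(Bürgisser–Hüttenhain–Ikenmeyer, Proc. AMS 145 (2017) = arXiv:1501.05528, §3: "`ψ_n : V^n // H_n →
Chow_n` ... Lemma 3 ([brion:93]). The morphism `ψ_n` is finite. We conclude that `ψ_n` is the
normalization of `Chow_n`"; Landsberg, arXiv:1305.7387, Prop. 7.8 with Lemmas 7.9–7.11: finiteness
from "`ψ_n⁻¹(0) = [0]`" by the graded Nakayama lemma).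

**Result** (`exists_symBalanced_subset_span_lowProducts`, characteristic zero): there is a degree
bound `a` such that every graded piece `𝒪(V^m // H_m)_n` lies in the `k`-span of the products
`r · b` with `r ∈ R` and `b ∈ 𝒪(V^m // H_m)_e`, `e < a` — i.e. `R̃` is generated as an `R`-module by
its finitely many (finite-dimensional) pieces of degree `< a`: BHI's Lemma 3.

**Proof** (the printed route, made effective): by `ChowCoeffIdeal.lean` every monomial of column
degrees `≥ a` lies in the ideal of `k[Mat_m]` generated by the pullbacks `x_d` of the linear
coordinates of `Sym^m` (the null-cone statement "`u_1⋯u_n = 0` iff some `u_j = 0`"); by the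
division lemma above (the Reynolds operator of `H_m`) an element of
`𝒪(V^m // H_m)_n`, `n ≥ a`, is therefore `∑_d x_d a_d` with `a_d ∈ 𝒪(V^m // H_m)_{n-1}` — the graded
Nakayama step (Landsberg Lemma 7.11); induction on `n`.

## References

* [BurgisserHuttenhainIkenmeyer2017] §3, Lemma 3.
* M. Brion, *Stable properties of plethysm: on two conjectures of Foulkes*, Manuscripta Math. 80
  (1993) 347–371 (the source of Lemma 3).
* J. M. Landsberg, arXiv:1305.7387, Prop. 7.8, Lemmas 7.9–7.11.
-/


open MvPolynomial

namespace Literature.Computability.AlgebraicComplexity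

variable {k : Type*} [Field k] (m : ℕ)

/-! ### The coefficient ideal with a finite set of generators -/

/-- The ideal generated by all `v`-coefficients of a polynomial is generated by the coefficients
in its (finite) support. [folklore] -/
theorem span_range_coeff_eq_span_range_coeff_support {R σ : Type*} [CommRing R]
    (p : MvPolynomial σ R) :
    Ideal.span (Set.range fun γ : σ →₀ ℕ => coeff γ p) =
      Ideal.span (Set.range fun γ : p.support => coeff γ.1 p) := by
  refine le_antisymm (Ideal.span_le.mpr ?_) (Ideal.span_mono ?_)
  · rintro _ ⟨γ, rfl⟩
    by_cases hγ : γ ∈ p.support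
    · exact Ideal.subset_span ⟨⟨γ, hγ⟩, rfl⟩
    · have h0 : coeff γ p = 0 := notMem_support_iff.mp hγ
      change coeff γ p ∈ _
      rw [h0]
      exact Ideal.zero_mem _
  · rintro _ ⟨γ, rfl⟩
    exact ⟨γ.1, rfl⟩

/-- The generic product is a form of degree `m` in `v`. [folklore] -/
theorem genericProduct_isHomogeneous : (genericProduct (k := k) m).IsHomogeneous m := by
  have h := prod_genericLinForm_pow_isHomogeneous (k := k) m Finset.univ 1
  simpa [genericProduct] using h

/-- **The `v`-coefficients of the generic product are pullbacks**: a coefficient in the support is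
`chowPullback (X_d)` for the corresponding degree-`m` index `d` (off degree `m` the coefficients
vanish). [cite: BurgisserHuttenhainIkenmeyer2017, §3 (comorphism of φ_n)] -/
theorem coeff_genericProduct_mem_range (γ : Fin m →₀ ℕ) :
    coeff γ (genericProduct (k := k) m) ∈ (chowPullback (k := k) m).range := by
  by_cases hγ : γ.degree = m
  · exact (AlgHom.mem_range _).mpr ⟨X ⟨γ, (mem_degMonomials_iff).mpr hγ⟩, chowPullback_X m _⟩
  · rw [(genericProduct_isHomogeneous (k := k) m).coeff_eq_zero hγ]
    exact Subalgebra.zero_mem _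

/-! ### The `R`-module generators of low degree -/

/-- The products `r · b`, `r ∈ R = im(chowPullback)`, `b ∈ 𝒪(V^m // H_m)_e` with `e < a`: the
candidate `R`-module generators of `R̃ = 𝒪(V^m // H_m)` (BHI Lemma 3: `𝒪(V^n // H_n)` is a finite
`𝒪(Chow_n)`-module). [cite: BurgisserHuttenhainIkenmeyer2017, §3 (Lemma 3)] -/
def lowProducts (a : ℕ) : Set (MvPolynomial (Fin m × Fin m) k) :=
  {z | ∃ r ∈ (chowPullback (k := k) m).range, ∃ e < a, ∃ b ∈ symBalanced m e, z = r * b}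

/-- An element of a low-degree piece is itself a low product (`r = 1`). [folklore] -/
theorem mem_lowProducts_of_mem_symBalanced {a e : ℕ} (he : e < a)
    {b : MvPolynomial (Fin m × Fin m) k} (hb : b ∈ symBalanced m e) :
    b ∈ lowProducts (k := k) m a :=
  ⟨1, Subalgebra.one_mem _, e, he, b, hb, (one_mul b).symm⟩

/-- The span of the low products is stable under multiplication by `R`. [folklore] -/
theorem mul_mem_span_lowProducts {a : ℕ} {r z : MvPolynomial (Fin m × Fin m) k}
    (hr : r ∈ (chowPullback (k := k) m).range)
    (hz : z ∈ Submodule.span k (lowProducts (k := k) m a)) :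
    r * z ∈ Submodule.span k (lowProducts (k := k) m a) := by
  refine Submodule.span_induction (p := fun z _ => r * z ∈ Submodule.span k (lowProducts m a))
    ?_ ?_ ?_ ?_ hz
  · rintro _ ⟨r', hr', e, he, b, hb, rfl⟩
    refine Submodule.subset_span ⟨r * r', Subalgebra.mul_mem _ hr hr', e, he, b, hb, ?_⟩
    ring
  · rw [mul_zero]
    exact Submodule.zero_mem _
  · intro x y _ _ hx hy
    rw [mul_add]
    exact Submodule.add_mem _ hx hy
  · intro c x _ hx
    rw [mul_smul_comm]
    exact Submodule.smul_mem _ c hx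

/-! ### BHI Lemma 3: `𝒪(V^m // H_m)` is a finite `𝒪(Chow_m)`-module -/

/-- **The graded Nakayama step** (Landsberg Lemma 7.11, for `ψ_m`): in characteristic zero, for
`n ≥ a := m(m-1)+1`, every `y ∈ 𝒪(V^m // H_m)_n` is `∑_d x_d a_d` with `x_d` the pullbacks of the
linear coordinates of `Sym^m` and `a_d ∈ 𝒪(V^m // H_m)_{n-1}`: its monomials have column degrees
`n ≥ a`, so `y` lies in the ideal generated by the `x_d` (`monomial_mem_span_coeff_genericProduct_pow`),
and the division lemma applies. [cite: BurgisserHuttenhainIkenmeyer2017, §3 (Lemma 3)] -/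
theorem exists_eq_sum_coeff_genericProduct_mul [CharZero k] {n : ℕ}
    (hn : m * (1 * ((m - 1) * 1 + 1) - 1) + 1 ≤ n) {y : MvPolynomial (Fin m × Fin m) k}
    (hy : y ∈ symBalanced m n) :
    ∃ a : (genericProduct (k := k) m ^ 1).support → MvPolynomial (Fin m × Fin m) k,
      (∀ γ, a γ ∈ symBalanced m (n - 1)) ∧
        y = ∑ γ, coeff γ.1 (genericProduct (k := k) m ^ 1) * a γ := by
  classical
  have hn1 : n = 1 + (n - 1) := by omega
  rw [hn1] at hy
  refine exists_eq_sum_mul_of_mem_span m (fun γ : (genericProduct (k := k) m ^ 1).support =>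
    coeff γ.1 (genericProduct (k := k) m ^ 1))
    (fun γ => coeff_genericProduct_pow_mem_symBalanced m 1 γ.1) hy ?_
  -- `y` lies in the ideal generated by the coefficients of the generic product
  rw [← span_range_coeff_eq_span_range_coeff_support, as_sum y]
  refine Ideal.sum_mem _ fun s hs => ?_
  refine monomial_mem_span_coeff_genericProduct_pow m 1 s (fun j => ?_) _
  rw [← hn1] at hy
  rw [((isBalanced_iff m n y).mp hy.1) s hs j]
  exact hn

/-- **BHI Lemma 3 (finiteness of the normalisation `ψ_m`), effective form.** In characteristic
zero there is a degree bound `a` such that for every `n`, every element of `𝒪(V^m // H_m)_n` lies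
in the `k`-span of the products `r · b`, `r ∈ 𝒪(Chow_m) = im(chowPullback)`, `b ∈ 𝒪(V^m // H_m)_e`
with `e < a`; i.e. `𝒪(V^m // H_m)` is generated as an `𝒪(Chow_m)`-module by its pieces of degree
`< a` (which are finite-dimensional). Printed: "Lemma 3 ([brion:93]). The morphism `ψ_n` is
finite." Proof: induction on `n` with the graded Nakayama step
`exists_eq_sum_coeff_genericProduct_mul`. [cite: BurgisserHuttenhainIkenmeyer2017, §3 (Lemma 3)] -/
theorem exists_symBalanced_subset_span_lowProducts [CharZero k] :
    ∃ a : ℕ, ∀ n : ℕ, ∀ y ∈ symBalanced m n,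
      y ∈ Submodule.span k (lowProducts (k := k) m a) := by
  classical
  set a := m * (1 * ((m - 1) * 1 + 1) - 1) + 1 with ha
  refine ⟨a, fun n => ?_⟩
  induction n using Nat.strong_induction_on with
  | _ n ih =>
    intro y hy
    by_cases hn : n < a
    · exact Submodule.subset_span (mem_lowProducts_of_mem_symBalanced m hn hy)
    · have hle : a ≤ n := not_lt.mp hn
      obtain ⟨b, hb, hyb⟩ := exists_eq_sum_coeff_genericProduct_mul m hle hy
      rw [hyb]
      refine Submodule.sum_mem _ fun γ _ => ?_
      refine mul_mem_span_lowProducts m ?_ (ih (n - 1) (by omega) _ (hb γ))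
      have h1 : genericProduct (k := k) m ^ 1 = genericProduct (k := k) m := pow_one _
      simp only [h1]
      exact coeff_genericProduct_mem_range m γ.1

end Literature.Computability.AlgebraicComplexity
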